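import Mathlib
import Literature.Combinatorics.Optimization.CorrelationPolytopeGridMinor
import Literature.Barriers.PneNP.ExtendedFormulationMinkowskiFaces
import Literature.Barriers.PneNP.CorrelationPolytopeXCLowerBoundGraph
import Summits.ValiantsHypothesis.ValiantsHypothesis.Theorems.FifoMatchingXcDivisionZmixDefs
import HarnessLib

/-!
# PROP E — the exposed-face / diagonal-shadow certificate: an extended formulation of `COR(K_n) + Z_mix(n)` is one, of the
# same size, of `COR(K_m)` (`m + m² ≤ n`)

Theorems-side port (director-valiant g13 R232 (a) / R233 (b) / R234 (d); port hand val-port-2 g1; `--supports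
stmt-ValiantsHypothesis-21181 --as helper`) of §10a–§10c of val-idea-7 g9's crux workfile
`Cruxes/NNLinearDegreeCofactorHard/Lines/xc_division.lean` rev 4.1 (@61de3b6b78b4, critic val-idea-crit-3 g3 by-name PASS
2026-08-28 12:00Z), verbatim bodies over the definitions file `…XcDivisionZmixDefs.lean`.  MECHANISM: (1) a support face of a
Minkowski sum is the sum of the two support faces and linear images distribute — IN THE TREE as val-lit-p10's
`HasEFOfSize.image_face_add_image_face₁` (`Literature/Barriers/PneNP/ExtendedFormulationMinkowskiFaces.lean`, consumed by
name); (2) `Z_mix(n)` lies in the off-diagonal subspace (`zmix_diag`), so the diagonal read sends every face of it to `{0}`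
(`diagRead_image_zmix_face`); (3) the AND-gadget direction `andDir ι` is valid on `COR(K_n)` with maximum `0` (Rosenberg
penalties `pen ≥ 0`, `= 0` iff consistent) and its face READ ON THE DIAGONAL SLOTS is exactly `COR(K_m)`
(`diagRead_image_cor_face`).  Hence ★★ `hasEFOfSize_cor_of_cor_add_zmix` and, with Kaibel–Weltge
(`corPolytopeGraph_top_two_pow_half_le`, tree), `two_pow_le_of_cor_add_zmix : 2^{m/2} ≤ r`.

HONEST FRAMING (R233 (b)): this decides ONE passenger (`Z_mix`) of the line's open problem COR-MINKOWSKI at rate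
`2^{(⌊√n⌋−1)/2}` (sibling file `…XcDivisionZmixCorHard.lean`); COR-MINKOWSKI `∀ Q` = LAW, OPEN; this is NOT stmt-21181
`NNDivisionHard` (OPEN); `VP ≠ VNP` is NOT proved; nothing here is a summit statement. [cite: FioriniEtAl2015, Lemma 9]
-/

set_option autoImplicit false

-- the mandated summit-side namespace repeats a component by design (single-problem summit)
set_option linter.dupNamespace false

noncomputable section

open Matrix Finset
open scoped Pointwise

namespace Summit.ValiantsHypothesis.ValiantsHypothesis.Theorems.FifoMatching

namespace XcDivision

open Literature.Barriers.PneNP (HasEFOfSize)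
open Literature.Combinatorics.Optimization (corPolytopeGraph corVec corVec_apply_diag corVec_apply_adj)

/-! ## Faces of hulls of finite families -/

/-- validity on a generating set passes to its convex hull. [folklore] -/
theorem dot_le_of_mem_convexHull {ι : Type} [Fintype ι] (S : Set (ι → ℝ)) (u : ι → ℝ) (δ : ℝ)
    (h : ∀ x ∈ S, u ⬝ᵥ x ≤ δ) : ∀ x ∈ convexHull ℝ S, u ⬝ᵥ x ≤ δ := by
  have hconv : Convex ℝ {x : ι → ℝ | u ⬝ᵥ x ≤ δ} :=
    convex_halfSpace_le ⟨fun x y => dotProduct_add u x y, fun c x => by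
      rw [dotProduct_smul, smul_eq_mul]⟩ δ
  exact fun x hx => (convexHull_min (fun x hx => (h x hx : x ∈ {x : ι → ℝ | u ⬝ᵥ x ≤ δ})) hconv) hx

/-- **A face of `conv{q j}` lies in the hull of the maximising generators.** [folklore] -/
theorem mem_convexHull_maximisers {ι J : Type} [Fintype ι] (q : J → ι → ℝ) (w : ι → ℝ) (δ : ℝ)
    (hle : ∀ j, w ⬝ᵥ q j ≤ δ) {y : ι → ℝ} (hy : y ∈ convexHull ℝ (Set.range q)) (hyw : w ⬝ᵥ y = δ) :
    y ∈ convexHull ℝ (Set.range fun j : {j : J // w ⬝ᵥ q j = δ} => q j.1) := by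
  classical
  rw [convexHull_range_eq_exists_affineCombination] at hy
  obtain ⟨s, μ, hμ0, hμ1, rfl⟩ := hy
  rw [Finset.affineCombination_eq_linear_combination s q μ hμ1] at hyw ⊢
  let wL : (ι → ℝ) →ₗ[ℝ] ℝ :=
    { toFun := fun x => w ⬝ᵥ x, map_add' := fun x y => dotProduct_add w x y,
      map_smul' := fun a x => by simp [dotProduct_smul] }
  have hsum : ∑ i ∈ s, μ i * (w ⬝ᵥ q i) = δ := by
    have : wL (∑ i ∈ s, μ i • q i) = ∑ i ∈ s, μ i * (w ⬝ᵥ q i) := by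
      rw [map_sum]
      refine Finset.sum_congr rfl fun i _ => ?_
      rw [map_smul]; rfl
    rw [← this]; exact hyw
  have hzero : ∀ i ∈ s, μ i * (δ - w ⬝ᵥ q i) = 0 := by
    have h0 : ∑ i ∈ s, μ i * (δ - w ⬝ᵥ q i) = 0 := by
      simp only [mul_sub, Finset.sum_sub_distrib, ← Finset.sum_mul, hμ1, one_mul, hsum, sub_self]
    exact (Finset.sum_eq_zero_iff_of_nonneg fun i hi =>
      mul_nonneg (hμ0 i hi) (sub_nonneg.2 (hle i))).1 h0
  rw [← Finset.centerMass_eq_of_sum_1 _ _ hμ1, ← Finset.centerMass_filter_ne_zero]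
  refine Finset.centerMass_mem_convexHull _ (fun i hi => hμ0 i (Finset.mem_filter.1 hi).1) ?_ ?_
  · rw [Finset.sum_filter_ne_zero, hμ1]; exact one_pos
  · intro i hi
    obtain ⟨his, hne⟩ := Finset.mem_filter.1 hi
    have hwi : w ⬝ᵥ q i = δ := by
      rcases mul_eq_zero.1 (hzero i his) with h0 | h0
      · exact absurd h0 hne
      · linarith
    exact ⟨⟨i, hwi⟩, rfl⟩

/-- the face of `conv{q j}` in direction `w` (cut at its maximum `δ`) is the hull of the maximising generators. -/
theorem convexHull_range_inter_eq {ι J : Type} [Fintype ι] (q : J → ι → ℝ) (w : ι → ℝ) (δ : ℝ)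
    (hle : ∀ j, w ⬝ᵥ q j ≤ δ) :
    convexHull ℝ (Set.range q) ∩ {y | w ⬝ᵥ y = δ} =
      convexHull ℝ (Set.range fun j : {j : J // w ⬝ᵥ q j = δ} => q j.1) := by
  ext y
  constructor
  · rintro ⟨hy, hyw⟩; exact mem_convexHull_maximisers q w δ hle hy hyw
  · intro hy
    refine ⟨convexHull_mono (by rintro _ ⟨j, rfl⟩; exact ⟨j.1, rfl⟩) hy, ?_⟩
    have h1 := dot_le_of_mem_convexHull _ w δ (by rintro _ ⟨j, rfl⟩; exact le_of_eq j.2) y hy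
    have h2 := dot_le_of_mem_convexHull _ (-w) (-δ)
      (by rintro _ ⟨j, rfl⟩; rw [neg_dotProduct]; exact neg_le_neg (le_of_eq j.2.symm)) y hy
    rw [neg_dotProduct] at h2
    show w ⬝ᵥ y = δ
    linarith

/-! ## `Z_mix(n)` is off-diagonal -/

/-- `E^s_{kl}` vanishes on the diagonal for `k ≠ l` -/
theorem eSym_diag {n : ℕ} {k l : Fin n} (hkl : k ≠ l) (i : Fin n) : eSym n k l (i, i) = 0 := by
  simp only [eSym]
  rw [if_neg]
  rintro (⟨h1, h2⟩ | ⟨h1, h2⟩)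
  · exact hkl (h1.symm.trans h2)
  · exact hkl (h2.symm.trans h1)

/-- the generators of `Z_mix(n)` vanish on the diagonal -/
theorem zmixDir_diag (n : ℕ) (g : Fin n × Fin n × Fin n) (i : Fin n) : zmixDir n g (i, i) = 0 := by
  unfold zmixDir
  split_ifs with h
  · rw [Pi.sub_apply, eSym_diag h.2.1 i, eSym_diag h.2.2 i, sub_zero]
  · rfl

/-- the signed generator sums vanish on the diagonal -/
theorem zmixPt_diag (n : ℕ) (ε : Fin n × Fin n × Fin n → Bool) (i : Fin n) : zmixPt n ε (i, i) = 0 := by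
  unfold zmixPt
  rw [Finset.sum_apply]
  exact Finset.sum_eq_zero fun g _ => by rw [Pi.smul_apply, zmixDir_diag, smul_zero]

/-- every point of `Z_mix(n)` has zero diagonal. -/
theorem zmix_diag {n : ℕ} {z : Fin n × Fin n → ℝ} (hz : z ∈ Zmix n) (i : Fin n) : z (i, i) = 0 := by
  have h1 := dot_le_of_mem_convexHull (Set.range (zmixPt n)) (Pi.single (i, i) 1) 0
    (by rintro _ ⟨ε, rfl⟩; rw [single_dotProduct, one_mul, zmixPt_diag]) z hz
  have h2 := dot_le_of_mem_convexHull (Set.range (zmixPt n)) (-Pi.single (i, i) 1) 0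
    (by rintro _ ⟨ε, rfl⟩; rw [neg_dotProduct, single_dotProduct, one_mul, zmixPt_diag, neg_zero]) z hz
  rw [neg_dotProduct, single_dotProduct, one_mul] at h2
  rw [single_dotProduct, one_mul] at h1
  linarith

/-! ## The AND-gadget face of `COR(K_n)` and the diagonal read -/

section Gadget

variable {m n : ℕ}

/-- `E_{pq} · x = x (p, q)` -/
theorem eFun_dot (p q : Fin n) (x : Fin n × Fin n → ℝ) : eFun n p q ⬝ᵥ x = x (p, q) := by
  rw [eFun, single_dotProduct, one_mul]

/-- the value of the gadget functional -/
theorem gadFun_dot (ι : Fin m ⊕ (Fin m × Fin m) ↪ Fin n) (g : Fin m × Fin m) (x : Fin n × Fin n → ℝ) :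
    gadFun ι g ⬝ᵥ x = -x (uSlot ι g.1, uSlot ι g.2) + 2 * x (uSlot ι g.1, wSlot ι g)
      + 2 * x (uSlot ι g.2, wSlot ι g) - 3 * x (wSlot ι g, wSlot ι g) := by
  simp only [gadFun, add_dotProduct, sub_dotProduct, neg_dotProduct, smul_dotProduct, smul_eq_mul, eFun_dot]

/-- the value of the AND-gadget direction -/
theorem andDir_dot (ι : Fin m ⊕ (Fin m × Fin m) ↪ Fin n) (x : Fin n × Fin n → ℝ) :
    andDir ι ⬝ᵥ x = ∑ g, gadFun ι g ⬝ᵥ x := by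
  rw [andDir, sum_dotProduct]

/-- entries of `corVec ⊤ b` (diagonal included): `[b p] · [b q]`. -/
theorem corVec_top_apply (b : Fin n → Bool) (p q : Fin n) :
    corVec (⊤ : SimpleGraph (Fin n)) b (p, q) = (if b p then 1 else 0) * (if b q then 1 else 0) := by
  by_cases hpq : p = q
  · subst hpq
    rw [corVec_apply_diag]
    cases hb : b p <;> simp
  · rw [corVec_apply_adj _ _ ((SimpleGraph.top_adj p q).2 hpq)]
    cases hb : b p <;> cases hb' : b q <;> simp

/-- `pen ≥ 0` on `{0,1}³` -/
theorem pen_nonneg (x y z : Bool) : 0 ≤ pen x y z := by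
  cases x <;> cases y <;> cases z <;> norm_num [pen]

/-- `pen x y z = 0 ↔ z = x ∧ y` -/
theorem pen_eq_zero_iff (x y z : Bool) : pen x y z = 0 ↔ z = (x && y) := by
  cases x <;> cases y <;> cases z <;> norm_num [pen]

/-- the gadget functional at a vertex of `COR(K_n)` is minus the penalty -/
theorem gadFun_dot_corVec (ι : Fin m ⊕ (Fin m × Fin m) ↪ Fin n) (g : Fin m × Fin m) (b : Fin n → Bool) :
    gadFun ι g ⬝ᵥ corVec ⊤ b = -pen (b (uSlot ι g.1)) (b (uSlot ι g.2)) (b (wSlot ι g)) := by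
  rw [gadFun_dot, corVec_top_apply, corVec_top_apply, corVec_top_apply, corVec_top_apply, pen]
  have hw : (if b (wSlot ι g) then (1 : ℝ) else 0) * (if b (wSlot ι g) then 1 else 0) =
      if b (wSlot ι g) then 1 else 0 := by
    cases hb : b (wSlot ι g) <;> simp
  rw [hw]; ring

/-- the AND-gadget direction at a vertex is minus the total penalty -/
theorem andDir_dot_corVec (ι : Fin m ⊕ (Fin m × Fin m) ↪ Fin n) (b : Fin n → Bool) :
    andDir ι ⬝ᵥ corVec ⊤ b = -∑ g, pen (b (uSlot ι g.1)) (b (uSlot ι g.2)) (b (wSlot ι g)) := by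
  rw [andDir_dot, ← Finset.sum_neg_distrib]
  exact Finset.sum_congr rfl fun g _ => gadFun_dot_corVec ι g b

/-- the AND-gadget direction is `≤ 0` at every vertex -/
theorem andDir_dot_corVec_le (ι : Fin m ⊕ (Fin m × Fin m) ↪ Fin n) (b : Fin n → Bool) :
    andDir ι ⬝ᵥ corVec ⊤ b ≤ 0 := by
  rw [andDir_dot_corVec, neg_nonpos]
  exact Finset.sum_nonneg fun g _ => pen_nonneg _ _ _

/-- `C · x ≤ 0` is VALID on `COR(K_n)`. -/
theorem andDir_valid (ι : Fin m ⊕ (Fin m × Fin m) ↪ Fin n) :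
    ∀ x ∈ corPolytopeGraph (⊤ : SimpleGraph (Fin n)), andDir ι ⬝ᵥ x ≤ 0 :=
  dot_le_of_mem_convexHull _ _ _ (by rintro _ ⟨b, rfl⟩; exact andDir_dot_corVec_le ι b)

/-- tight vertices are gadget-consistent: `b_{w_ij} = b_{u_i} ∧ b_{u_j}`. -/
theorem consistent_of_andDir_dot_eq_zero (ι : Fin m ⊕ (Fin m × Fin m) ↪ Fin n) {b : Fin n → Bool}
    (h : andDir ι ⬝ᵥ corVec ⊤ b = 0) (g : Fin m × Fin m) :
    b (wSlot ι g) = (b (uSlot ι g.1) && b (uSlot ι g.2)) := by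
  rw [andDir_dot_corVec, neg_eq_zero, Finset.sum_eq_zero_iff_of_nonneg (fun g _ => pen_nonneg _ _ _)] at h
  exact (pen_eq_zero_iff _ _ _).1 (h g (Finset.mem_univ g))

/-- the lift takes the slot values on the slots -/
theorem liftBool_apply (ι : Fin m ⊕ (Fin m × Fin m) ↪ Fin n) (b' : Fin m → Bool)
    (s : Fin m ⊕ (Fin m × Fin m)) : liftBool ι b' (ι s) = slotVal b' s := by
  unfold liftBool
  cases hs : slotVal b' s
  · rw [decide_eq_false_iff_not]
    rintro ⟨s', h1, h2⟩
    rw [ι.injective h1, hs] at h2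
    exact Bool.false_ne_true h2
  · exact decide_eq_true ⟨s, rfl, hs⟩

/-- the lift is gadget-consistent -/
theorem liftBool_wSlot (ι : Fin m ⊕ (Fin m × Fin m) ↪ Fin n) (b' : Fin m → Bool) (g : Fin m × Fin m) :
    liftBool ι b' (wSlot ι g) = (liftBool ι b' (uSlot ι g.1) && liftBool ι b' (uSlot ι g.2)) := by
  simp only [wSlot, uSlot, liftBool_apply]; rfl

/-- lifted vertices are tight for the AND-gadget direction -/
theorem andDir_dot_corVec_liftBool (ι : Fin m ⊕ (Fin m × Fin m) ↪ Fin n) (b' : Fin m → Bool) :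
    andDir ι ⬝ᵥ corVec ⊤ (liftBool ι b') = 0 := by
  rw [andDir_dot_corVec, neg_eq_zero]
  exact Finset.sum_eq_zero fun g _ => (pen_eq_zero_iff _ _ _).2 (liftBool_wSlot ι b' g)

/-- every read position is diagonal -/
theorem slotPos_diag (ι : Fin m ⊕ (Fin m × Fin m) ↪ Fin n) (g : Fin m × Fin m) : ∃ p, slotPos ι g = (p, p) := by
  obtain ⟨i, j⟩ := g
  rw [slotPos]
  split_ifs <;> exact ⟨_, rfl⟩

/-- the diagonal read, pointwise -/
theorem diagRead_apply (ι : Fin m ⊕ (Fin m × Fin m) ↪ Fin n) (x : Fin n × Fin n → ℝ) (g : Fin m × Fin m) :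
    diagRead ι x g = x (slotPos ι g) := rfl

/-- the diagonal read kills `Z_mix(n)`. -/
theorem diagRead_zmix (ι : Fin m ⊕ (Fin m × Fin m) ↪ Fin n) {z : Fin n × Fin n → ℝ} (hz : z ∈ Zmix n) :
    diagRead ι z = 0 := by
  funext g
  obtain ⟨p, hp⟩ := slotPos_diag ι g
  rw [diagRead_apply, hp, zmix_diag hz]; rfl

/-- the diagonal read of a gadget-consistent vertex of `COR(K_n)` is the vertex of `COR(K_m)` of its vertex-slot values. -/
theorem diagRead_corVec (ι : Fin m ⊕ (Fin m × Fin m) ↪ Fin n) {b : Fin n → Bool}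
    (hb : ∀ g : Fin m × Fin m, b (wSlot ι g) = (b (uSlot ι g.1) && b (uSlot ι g.2))) :
    diagRead ι (corVec ⊤ b) = corVec (⊤ : SimpleGraph (Fin m)) (fun i => b (uSlot ι i)) := by
  funext g
  obtain ⟨i, j⟩ := g
  rw [diagRead_apply, slotPos]
  by_cases hij : i = j
  · subst hij
    rw [if_pos rfl, corVec_apply_diag, corVec_apply_diag]
  · rw [if_neg hij, corVec_apply_diag, corVec_apply_adj _ _ ((SimpleGraph.top_adj i j).2 hij), hb (i, j)]

/-- ★ **CLAIM A — the gadget face of `COR(K_n)` read on the diagonal IS `COR(K_m)`.** -/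
theorem diagRead_image_cor_face (ι : Fin m ⊕ (Fin m × Fin m) ↪ Fin n) :
    diagRead ι '' (corPolytopeGraph (⊤ : SimpleGraph (Fin n)) ∩ {x | andDir ι ⬝ᵥ x = 0}) =
      corPolytopeGraph (⊤ : SimpleGraph (Fin m)) := by
  unfold corPolytopeGraph
  rw [convexHull_range_inter_eq _ (andDir ι) 0 (andDir_dot_corVec_le ι), LinearMap.image_convexHull,
    ← Set.range_comp]
  congr 1
  ext y
  constructor
  · rintro ⟨⟨b, hb⟩, rfl⟩
    exact ⟨fun i => b (uSlot ι i), (diagRead_corVec ι (consistent_of_andDir_dot_eq_zero ι hb)).symm⟩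
  · rintro ⟨b', rfl⟩
    refine ⟨⟨liftBool ι b', andDir_dot_corVec_liftBool ι b'⟩, ?_⟩
    show diagRead ι (corVec ⊤ (liftBool ι b')) = corVec ⊤ b'
    rw [diagRead_corVec ι (fun g => liftBool_wSlot ι b' g)]
    congr 1
    funext i
    exact liftBool_apply ι b' (Sum.inl i)

/-- a functional on a signed generator sum -/
theorem dot_zmixPt (C : Fin n × Fin n → ℝ) (ε : Fin n × Fin n × Fin n → Bool) :
    C ⬝ᵥ zmixPt n ε = ∑ g, (if ε g then (1 : ℝ) else -1) * (C ⬝ᵥ zmixDir n g) := by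
  unfold zmixPt
  rw [dotProduct_sum]
  exact Finset.sum_congr rfl fun g _ => by rw [dotProduct_smul, smul_eq_mul]

/-- the argmax sign pattern maximises -/
theorem dot_zmixPt_le (C : Fin n × Fin n → ℝ) (ε : Fin n × Fin n × Fin n → Bool) :
    C ⬝ᵥ zmixPt n ε ≤ C ⬝ᵥ zmixPt n (zmixArgmax C) := by
  rw [dot_zmixPt, dot_zmixPt]
  refine Finset.sum_le_sum fun g _ => ?_
  have key : (if zmixArgmax C g then (1 : ℝ) else -1) * (C ⬝ᵥ zmixDir n g) = |C ⬝ᵥ zmixDir n g| := by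
    unfold zmixArgmax
    by_cases h : 0 ≤ C ⬝ᵥ zmixDir n g
    · rw [abs_of_nonneg h]; simp [h]
    · rw [abs_of_neg (not_le.1 h)]; simp [h]
  rw [key]
  split_ifs
  · rw [one_mul]; exact le_abs_self _
  · rw [neg_one_mul]; exact neg_le_abs _

/-- `C · y ≤ C · zmixPt (argmax)` is VALID on `Z_mix(n)` (and tight at a generator sum, so the face is nonempty). -/
theorem valid_zmix (C : Fin n × Fin n → ℝ) : ∀ y ∈ Zmix n, C ⬝ᵥ y ≤ C ⬝ᵥ zmixPt n (zmixArgmax C) :=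
  dot_le_of_mem_convexHull _ _ _ (by rintro _ ⟨ε, rfl⟩; exact dot_zmixPt_le C ε)

/-- ★ **CLAIM B — every support face of `Z_mix(n)` reads as `{0}` on the diagonal.** -/
theorem diagRead_image_zmix_face (ι : Fin m ⊕ (Fin m × Fin m) ↪ Fin n) (C : Fin n × Fin n → ℝ) :
    diagRead ι '' (Zmix n ∩ {y | C ⬝ᵥ y = C ⬝ᵥ zmixPt n (zmixArgmax C)}) = {0} := by
  refine Set.eq_singleton_iff_unique_mem.2 ⟨?_, ?_⟩
  · have hmem : zmixPt n (zmixArgmax C) ∈ Zmix n := subset_convexHull ℝ _ ⟨_, rfl⟩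
    exact ⟨zmixPt n (zmixArgmax C), ⟨hmem, rfl⟩, diagRead_zmix ι hmem⟩
  · rintro _ ⟨y, ⟨hy, -⟩, rfl⟩
    exact diagRead_zmix ι hy

/-- ★★ **PROP E — the exposed-face / diagonal-shadow certificate**: an extended formulation of `COR(K_n) + Z_mix(n)` is one,
of the same size, of `COR(K_m)`, for every injective slot assignment `Fin m ⊕ (Fin m × Fin m) ↪ Fin n`. -/
theorem hasEFOfSize_cor_of_cor_add_zmix_emb (ι : Fin m ⊕ (Fin m × Fin m) ↪ Fin n) {r : ℕ}
    (h : HasEFOfSize (corPolytopeGraph (⊤ : SimpleGraph (Fin n)) + Zmix n) r) :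
    HasEFOfSize (corPolytopeGraph (⊤ : SimpleGraph (Fin m))) r := by
  have h1 := h.image_face_add_image_face₁ (andDir ι) 0 (andDir ι ⬝ᵥ zmixPt n (zmixArgmax (andDir ι)))
    (andDir_valid ι) (valid_zmix (andDir ι)) (diagRead ι)
  rwa [diagRead_image_cor_face, diagRead_image_zmix_face, Set.singleton_zero, add_zero] at h1

end Gadget

/-- ★★ `HasEFOfSize (COR(K_n) + Z_mix(n)) r → HasEFOfSize (COR(K_m)) r` whenever `m + m² ≤ n`. -/
theorem hasEFOfSize_cor_of_cor_add_zmix {m n r : ℕ} (hmn : m + m * m ≤ n)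
    (h : HasEFOfSize (corPolytopeGraph (⊤ : SimpleGraph (Fin n)) + Zmix n) r) :
    HasEFOfSize (corPolytopeGraph (⊤ : SimpleGraph (Fin m))) r := by
  have hne : Nonempty (Fin m ⊕ (Fin m × Fin m) ↪ Fin n) := by
    rw [Function.Embedding.nonempty_iff_card_le]
    simpa using hmn
  exact hasEFOfSize_cor_of_cor_add_zmix_emb hne.some h

/-- ★★ **`xc(COR(K_n) + Z_mix(n)) ≥ 2^{m/2}`** for every `m ≥ 4` with `m + m² ≤ n` (PROP E + Kaibel–Weltge). -/
theorem two_pow_le_of_cor_add_zmix {m n r : ℕ} (hm : 4 ≤ m) (hmn : m + m * m ≤ n)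
    (h : HasEFOfSize (corPolytopeGraph (⊤ : SimpleGraph (Fin n)) + Zmix n) r) :
    (2 : ℝ) ^ ((m : ℝ) / 2) ≤ r :=
  Literature.Barriers.PneNP.corPolytopeGraph_top_two_pow_half_le hm (hasEFOfSize_cor_of_cor_add_zmix hmn h)

end XcDivision

end Summit.ValiantsHypothesis.ValiantsHypothesis.Theorems.FifoMatching

end
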